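import Mathlib
import HarnessLib
import Summits.HubbardSuperconductivity.HubbardSuperconductivity.Theorems.KLProgrammeKLRegimeEngineFlowSliceWeights
import Summits.HubbardSuperconductivity.HubbardSuperconductivity.Theorems.KLProgrammeForwardBubbleRay

/-!
# Route `KLProgramme` — ENGINE item stmt-HubbardSuperconductivity-20437 `KLRegimeEngineV17F2`, class-#5 STEP (X).3 rows form / (c) `hout` rows:
# THE PROPAGATOR DICTIONARY — the literal lines of the STEP (`Wd t p·(βL²·ĝ_K p)`, `Φ_j(t)(p)·(βL²·ĝ_K p)`, the `D`-line) in the form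
# `βL²·klfb_prop f (ω_i) (e_K(k))` the lattice ph-loop rows read (cell gate-hubbard-kl, seat hubbard-kl-k3c2-p2 g17)

Sequel to `…EngineFlowSliceWeights` (the weights `klWdC`, `klPhiC` as functions of `s = ω² + e_K²`).  Here: `klfb_prop f ω_i (e_K(k)) =
f(ω_i² + e_K(k)²)·ĝ_K(i,k)` (`klfw_klfb_prop_eq`; `ĝ_K = propCT`, the fermionic frequency never vanishes), and the three weighted lines of
`klmd_defect_le_rows_family` / `klmd_defectDiff_le_rows_family` rewritten BY NAME: `klfw_sliceLine_eq`, `klfw_memberLine_eq`, `klfw_dLine_line_eq`.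
Pure rewriting; nothing about the model's effective action is asserted; nothing asserts (X).3, (c), K3 or superconductivity.
-/

noncomputable section

namespace Summit.HubbardSuperconductivity.HubbardSuperconductivity.Theorems.KLRegimeSplit

set_option linter.dupNamespace false -- summit = problem name (single-conjunct summit), D-0017

open Real Set Complex Literature.MathematicalPhysics.QuantumLattice Literature.Probability.LatticeModels
open Summit.HubbardSuperconductivity.HubbardSuperconductivity.Theorems.KLProgrammeLegKernels
open Summit.HubbardSuperconductivity.HubbardSuperconductivity.Theorems.KLRegimeWick
open Summit.HubbardSuperconductivity.HubbardSuperconductivity.Theorems.TwoPointAssembly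

variable {L M : ℕ} (μ : ℝ) (K : TrigPolyC4v)

/-! ## §4 The propagator dictionary -/

/-- **`klfb_prop f ω_i (e_K(k)) = f(ω_i² + e_K(k)²)·ĝ_K(i,k)`** (`β ≠ 0`: the fermionic frequency never vanishes, so `ω² + e² ≠ 0`). -/
theorem klfw_klfb_prop_eq {β : ℝ} (hβ : β ≠ 0) (f : ℝ → ℂ) (p : FreqMomentum L M) :
    klfb_prop f (matsubaraFreq β M p.1) (nambuXiCT L μ K p.2) = f (matsubaraFreq β M p.1 ^ 2 + nambuXiCT L μ K p.2 ^ 2) * propCT L M β μ K p := by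
  unfold klfb_prop propCT
  set ω : ℝ := matsubaraFreq β M p.1
  set e : ℝ := nambuXiCT L μ K p.2
  have hω : ω ≠ 0 := matsubaraFreq_ne_zero hβ _
  have hE : ((ω ^ 2 + e ^ 2 : ℝ) : ℂ) = (-I * ω + e) * (I * ω + e) := by
    push_cast
    linear_combination (ω : ℂ) ^ 2 * Complex.I_mul_I
  have hE0 : (ω ^ 2 + e ^ 2 : ℝ) ≠ 0 := by positivity
  have hne : ((ω ^ 2 + e ^ 2 : ℝ) : ℂ) ≠ 0 := Complex.ofReal_ne_zero.2 hE0
  have hne' : (-I * ω + e : ℂ) ≠ 0 := fun h => hne (by rw [hE, h, zero_mul])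
  have hne'' : (I * ω + e : ℂ) ≠ 0 := fun h => hne (by rw [hE, h, mul_zero])
  rw [hE]
  field_simp

/-- **The model's weighted line in the rows' form**: if `w = W(ω² + e_K²)` then `w·(βL²·ĝ_K(p)) = βL²·klfb_prop W ω e`. -/
theorem klfw_weightedLine_eq {β : ℝ} (hβ : β ≠ 0) (W : ℝ → ℂ) {w : ℂ} (p : FreqMomentum L M)
    (hw : w = W (matsubaraFreq β M p.1 ^ 2 + nambuXiCT L μ K p.2 ^ 2)) :
    w * ((((β * (L : ℝ) ^ 2 : ℝ)) : ℂ) * propCT L M β μ K p) =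
      (((β * (L : ℝ) ^ 2 : ℝ)) : ℂ) * klfb_prop W (matsubaraFreq β M p.1) (nambuXiCT L μ K p.2) := by
  rw [klfw_klfb_prop_eq μ K hβ, hw]; ring

/-- **The slice line of the STEP**: `Wd t p·(βL²·ĝ) = βL²·klfb_prop (klWdC Λ) ω e` at `Λ = Λ(t) ≠ 0`. -/
theorem klfw_sliceLine_eq {β : ℝ} (hβ : β ≠ 0) {Λ : ℝ} (hΛ : Λ ≠ 0) (p : FreqMomentum L M) :
    (((deriv (fun Λ' : ℝ => hubbardCutoffWeightCT L M β μ K Λ' p) Λ : ℝ)) : ℂ) * ((((β * (L : ℝ) ^ 2 : ℝ)) : ℂ) * propCT L M β μ K p) =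
      (((β * (L : ℝ) ^ 2 : ℝ)) : ℂ) * klfb_prop (klWdC Λ) (matsubaraFreq β M p.1) (nambuXiCT L μ K p.2) :=
  klfw_weightedLine_eq μ K hβ (klWdC Λ) p (by rw [klfw_Wd_eq_klWd β μ K hΛ, klWdC])

/-- **The member line of the STEP**: `Φ_j(t)(p)·(βL²·ĝ) = βL²·klfb_prop (klPhiC Λ_j Λ) ω e`. -/
theorem klfw_memberLine_eq {β : ℝ} (hβ : β ≠ 0) (n j : ℕ) (Λ : ℝ) (p : FreqMomentum L M) :
    (((softSymbolCompl L M β μ K (n + 1) j p +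
          (hubbardCutoffWeightCT L M β μ K (klScale klE0 (n + 1)) p - hubbardCutoffWeightCT L M β μ K Λ p) : ℝ)) : ℂ) *
        ((((β * (L : ℝ) ^ 2 : ℝ)) : ℂ) * propCT L M β μ K p) =
      (((β * (L : ℝ) ^ 2 : ℝ)) : ℂ) * klfb_prop (klPhiC (klScale klE0 j) Λ) (matsubaraFreq β M p.1) (nambuXiCT L μ K p.2) :=
  klfw_weightedLine_eq μ K hβ (klPhiC (klScale klE0 j) Λ) p (by rw [klfw_memberSymbol_eq β μ K n j Λ p, klPhiC])

/-- **The `D`-line of the STEP**: `(s_{n+1,j} − s_{n+1,j′})(p)·(βL²·ĝ) = βL²·klfb_prop (klPhiC Λ_j Λ_{j′}) ω e`. -/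
theorem klfw_dLine_line_eq {β : ℝ} (hβ : β ≠ 0) (n j j' : ℕ) (p : FreqMomentum L M) :
    (((softSymbolCompl L M β μ K (n + 1) j p - softSymbolCompl L M β μ K (n + 1) j' p : ℝ)) : ℂ) *
        ((((β * (L : ℝ) ^ 2 : ℝ)) : ℂ) * propCT L M β μ K p) =
      (((β * (L : ℝ) ^ 2 : ℝ)) : ℂ) * klfb_prop (klPhiC (klScale klE0 j) (klScale klE0 j')) (matsubaraFreq β M p.1) (nambuXiCT L μ K p.2) :=
  klfw_weightedLine_eq μ K hβ (klPhiC (klScale klE0 j) (klScale klE0 j')) p (by rw [klfw_dLine_eq β μ K n j j' p, klPhiC])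

end Summit.HubbardSuperconductivity.HubbardSuperconductivity.Theorems.KLRegimeSplit

end
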